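import Literature.AnabelianGeometry.SemiGraphs.TemperedGroups
import Mathlib.Topology.Algebra.OpenSubgroup
import Mathlib.Topology.Algebra.ClopenNhdofOne
import Mathlib.Topology.Algebra.ContinuousMonoidHom
import Mathlib.Topology.Instances.Discrete
import Mathlib.Topology.Instances.Int
import HarnessLib

/-!
# A tempered group from a profinite group with a `Ẑ`-valued character: the fibre product
# `Π = P ×_{Ẑ} ℤ` (pro-discrete, complete, second countable) — [SemiAnbd] Def. 3.1 (i) model, part A

Mochizuki, *Semi-graphs of anabelioids*, Publ. RIMS **42** (2006) [SemiAnbd], Def. 3.1 (i) p. 33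
("tempered" = inverse limit of countable discrete groups) and Example 3.10 pp. 43–45; [EtTh] §1 p. 12
("the natural surjection `Π^tp_X ↠ Z`", `Π_X := (Π^tp_X)^∧`). abc-iut cell, wave-5 prover seat
abc-iut-w5-d218 (gen 2); vacuity lane (towards a kernel inhabitant of the L3 interface
`OncePuncturedTemperedGroup`, `TemperedCurves.lean`). PROOF-ONLY (no definition, no instance, no named
fact): every statement is about an ARBITRARY subgroup `Π ≤ P × ℤ` characterised by a hypothesis.

SETTING. `P` a profinite topological group, `Z` a Hausdorff topological group, `e : P →ₜ* Z` a
continuous homomorphism, `ι : ℤ →* Z` (multiplicatively: `Multiplicative ℤ`), and `Π ≤ P × ℤ`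
(`ℤ` discrete) the subgroup with `(x, n) ∈ Π ↔ e x = ι n` — the FIBRE PRODUCT `P ×_Z ℤ`. In the model
`P = F̂₂`, `Z = Ẑ`, `e` = the completed exponent sum, `Π ∩ (P × 0) = Ker e × 0` plays the part of the
open profinite subgroup `Π^tp_Y ⊆ Π^tp_X` and `pr₂ : Π ↠ ℤ` that of `Π^tp_X ↠ Z`. Results:
* `exists_openNormal_mem_iff` — for `V ⊴ P` open, `N_V := (V × 0) ∩ Π` is an open normal subgroup of `Π`
  of countable index; `exists_openNormal_le_of_mem_nhds` — the `N_V` form a basis of neighbourhoods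
  of `1` in `Π`;
* `isTempered` — **`Π` is tempered** in the sense of the tree's `SemiGraphs.IsTempered` (basis of open
  normal subgroups of countable index, separated, and COMPLETE: a compatible family of cosets modulo
  the open normal subgroups lifts — via the completeness of the profinite `P`
  (`IsTempered.of_profinite`) and the Hausdorffness of `Z`);
* `secondCountableTopology` — `Π` is second countable when `P` is;
* `isOpen_ker_snd`, `snd_surjective_of` — the discrete quotient `Π → ℤ` has open kernel, and is onto as
  soon as every `ι n` is a value of `e`; `fst_injective` — `pr₁ : Π → P` is injective when `ι` is.
HONEST FRAMING: classical topology/group theory; nothing of [SemiAnbd]/[EtTh] is asserted; a model is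
consistency evidence only; no side is taken on any disputed claim.
-/

noncomputable section

open Topology Filter Set Function

universe u v

namespace Literature.AnabelianGeometry.SemiGraphs

namespace TemperedFibreProduct

variable {P : Type u} [Group P] [TopologicalSpace P] [IsTopologicalGroup P] [CompactSpace P]
  [TotallyDisconnectedSpace P]
variable {Z : Type v} [Group Z] [TopologicalSpace Z] [T2Space Z]
variable (e : P →ₜ* Z) (ι : Multiplicative ℤ →* Z)
variable (Γ : Subgroup (P × Multiplicative ℤ)) (hΓ : ∀ p, p ∈ Γ ↔ e p.1 = ι p.2)

/-! ### The open normal subgroups `N_V = (V × 0) ∩ Π` -/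

omit [TotallyDisconnectedSpace P] in
/-- For an open normal subgroup `V ⊴ P`, the slice `N_V := {(x, n) ∈ Π | x ∈ V, n = 0}` is an OPEN
NORMAL subgroup of `Π` of COUNTABLE index (`Π/N_V ↪ P/V × ℤ` with `P/V` finite) — recorded as an
existence statement with the membership characterisation ([SemiAnbd] Def. 3.1 (i): the terms of the
inverse system). [cite: MochizukiSemiAnbd2006, Def 3.1(i) p.33] -/
theorem exists_openNormal_mem_iff (V : OpenNormalSubgroup P) :
    ∃ N : OpenNormalSubgroup Γ, Countable (Γ ⧸ N.toSubgroup) ∧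
      ∀ q : Γ, q ∈ N ↔ (q : P × Multiplicative ℤ).1 ∈ V ∧ (q : P × Multiplicative ℤ).2 = 1 := by
  haveI : V.toSubgroup.Normal := V.isNormal'
  -- `N_V` as the kernel of `Γ → P/V × ℤ`
  let φ : Γ →* (P ⧸ V.toSubgroup) × Multiplicative ℤ :=
    ((QuotientGroup.mk' V.toSubgroup).prodMap (MonoidHom.id (Multiplicative ℤ))).comp Γ.subtype
  have hmem : ∀ q : Γ, q ∈ φ.ker ↔
      (q : P × Multiplicative ℤ).1 ∈ V ∧ (q : P × Multiplicative ℤ).2 = 1 := by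
    intro q
    rw [MonoidHom.mem_ker]
    change ((QuotientGroup.mk' V.toSubgroup (q : P × Multiplicative ℤ).1,
      (q : P × Multiplicative ℤ).2) : (P ⧸ V.toSubgroup) × Multiplicative ℤ) = 1 ↔ _
    rw [Prod.mk_eq_one, QuotientGroup.mk'_apply, QuotientGroup.eq_one_iff]
    rfl
  have hopen : IsOpen (φ.ker : Set Γ) := by
    have : (φ.ker : Set Γ) = Subtype.val ⁻¹' ((V : Set P) ×ˢ ({1} : Set (Multiplicative ℤ))) := by
      ext q
      rw [SetLike.mem_coe, hmem, Set.mem_preimage, Set.mem_prod, Set.mem_singleton_iff]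
      rfl
    rw [this]
    exact (V.isOpen'.prod (isOpen_discrete _)).preimage continuous_subtype_val
  refine ⟨⟨⟨φ.ker, hopen⟩, inferInstance⟩, ?_, hmem⟩
  -- countable index: `Γ / Ker φ ≃ range φ ⊆ P/V × ℤ`
  change Countable (Γ ⧸ φ.ker)
  haveI : Countable (Multiplicative ℤ) := Countable.of_equiv ℤ Multiplicative.ofAdd
  exact Countable.of_equiv _ (QuotientGroup.quotientKerEquivRange φ).toEquiv.symm

/-- The slices `N_V` form a BASIS of neighbourhoods of `1` in `Π`: every neighbourhood `U` of `1`
contains some `N_V` (open normal subgroups are a basis in the profinite `P`,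
`ProfiniteGrp.exist_openNormalSubgroup_sub_open_nhds_of_one`, and `{0}` is open in `ℤ`).
[cite: MochizukiSemiAnbd2006, Def 3.1(i) p.33] -/
theorem exists_openNormal_le_of_mem_nhds {U : Set Γ} (hU : U ∈ 𝓝 (1 : Γ)) :
    ∃ (V : OpenNormalSubgroup P) (N : OpenNormalSubgroup Γ), Countable (Γ ⧸ N.toSubgroup) ∧
      (∀ q : Γ, q ∈ N ↔ (q : P × Multiplicative ℤ).1 ∈ V ∧ (q : P × Multiplicative ℤ).2 = 1) ∧
      (N : Set Γ) ⊆ U := by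
  -- `U ⊇ Γ ∩ O` for an ambient neighbourhood `O` of `1`, `O ⊇ O₁ × O₂`
  rw [mem_nhds_subtype] at hU
  obtain ⟨O, hO, hOU⟩ := hU
  have h1 : ((1 : Γ) : P × Multiplicative ℤ) = ((1 : P), (1 : Multiplicative ℤ)) := rfl
  rw [h1, mem_nhds_prod_iff] at hO
  obtain ⟨O₁, hO₁, O₂, hO₂, hOO⟩ := hO
  obtain ⟨W, hWO, hWopen, h1W⟩ := mem_nhds_iff.mp hO₁
  obtain ⟨V, hV⟩ := ProfiniteGrp.exist_openNormalSubgroup_sub_open_nhds_of_one hWopen h1W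
  obtain ⟨N, hNc, hN⟩ := exists_openNormal_mem_iff Γ V
  refine ⟨V, N, hNc, hN, fun q hq => ?_⟩
  have hq' := (hN q).mp hq
  apply hOU
  rw [Set.mem_preimage]
  apply hOO
  refine Set.mk_mem_prod (hWO (hV hq'.1)) ?_
  rw [hq'.2]
  exact mem_of_mem_nhds hO₂

/-! ### `Π` is tempered -/

include hΓ in
/-- **The fibre product `Π = P ×_Z ℤ` is a tempered group** ([SemiAnbd] Def. 3.1 (i) p. 33 in the
tree's intrinsic form `IsTempered`): (a) the slices `N_V` are open normal of countable index and form a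
basis of neighbourhoods of `1`; (b) `Π` is Hausdorff, so they separate points; (c) COMPLETENESS — a
family of cosets `x_N ∈ Π/N` compatible under `N ≤ M` comes from an element: the `P`-components
`mod V` form a compatible family in the profinite (hence complete, `IsTempered.of_profinite`) group `P`
and lift to some `y`; the `ℤ`-components are constant `= n`; and `(y, n) ∈ Π` because `e y ∈ ι n · e(V)`
for every `V` while `e(V)` shrinks to `1` in the Hausdorff group `Z`.
[cite: MochizukiSemiAnbd2006, Def 3.1(i) p.33] -/
theorem isTempered : IsTempered Γ := by
  classical
  refine ⟨fun U hU => ?_, fun g hg => ?_, fun x hx => ?_⟩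
  · -- (a) basis
    obtain ⟨V, N, hNc, -, hNU⟩ := exists_openNormal_le_of_mem_nhds Γ hU
    exact ⟨N, hNc, hNU⟩
  · -- (b) separated: `{g}ᶜ` is a neighbourhood of `1`
    have hU : ({g}ᶜ : Set Γ) ∈ 𝓝 (1 : Γ) :=
      (isOpen_compl_singleton).mem_nhds (by simpa using hg.symm)
    obtain ⟨V, N, -, -, hNU⟩ := exists_openNormal_le_of_mem_nhds Γ hU
    exact ⟨N, fun h => hNU h rfl⟩
  · -- (c) complete
    -- choose the slices `N V` and representatives `p V` of `x (N V)`
    choose N hNc hN using fun V : OpenNormalSubgroup P => exists_openNormal_mem_iff Γ V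
    let p : OpenNormalSubgroup P → Γ := fun V => Quotient.out (x (N V))
    have hp : ∀ V, x (N V) = (p V : Γ ⧸ (N V).toSubgroup) := fun V => (Quotient.out_eq _).symm
    -- monotonicity of the slices
    have hNmono : ∀ V V' : OpenNormalSubgroup P, V ≤ V' → N V ≤ N V' := by
      intro V V' h q hq
      have hq' := (hN V q).mp hq
      exact (hN V' q).mpr ⟨h hq'.1, hq'.2⟩
    -- compatibility of representatives: `(p V')⁻¹ * p V ∈ N V'` for `V ≤ V'`
    have hcompat : ∀ V V' : OpenNormalSubgroup P, V ≤ V' → (p V')⁻¹ * p V ∈ N V' := by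
      intro V V' h
      have h1 : x (N V') = (p V : Γ ⧸ (N V').toSubgroup) := hx (N V) (N V') (hNmono V V' h) (p V) (hp V)
      rw [hp V'] at h1
      exact QuotientGroup.eq.mp h1
    -- the `P`-components form a compatible family modulo the open normal subgroups of `P`
    let y : (V : OpenNormalSubgroup P) → P ⧸ V.toSubgroup :=
      fun V => ((p V : P × Multiplicative ℤ).1 : P ⧸ V.toSubgroup)
    have hy : ∀ V V' : OpenNormalSubgroup P, V ≤ V' → ∀ g : P,
        y V = (g : P ⧸ V.toSubgroup) → y V' = (g : P ⧸ V'.toSubgroup) := by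
      intro V V' h g hg
      have hc := ((hN V' _).mp (hcompat V V' h)).1
      -- `(p V').1⁻¹ * (p V).1 ∈ V'` and `(p V).1⁻¹ * g ∈ V ≤ V'`
      have hg' : ((p V : P × Multiplicative ℤ).1)⁻¹ * g ∈ V.toSubgroup := QuotientGroup.eq.mp hg
      change (((p V' : P × Multiplicative ℤ).1 : P ⧸ V'.toSubgroup)) = (g : P ⧸ V'.toSubgroup)
      rw [QuotientGroup.eq]
      have hc' : ((p V' : P × Multiplicative ℤ).1)⁻¹ * (p V : P × Multiplicative ℤ).1 ∈ V'.toSubgroup :=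
        hc
      have hmul := V'.toSubgroup.mul_mem hc' (h hg')
      rwa [mul_assoc, mul_inv_cancel_left] at hmul
    obtain ⟨y₀, hy₀⟩ := (IsTempered.of_profinite (G := P)).complete y hy
    -- the `ℤ`-components are constant
    let V₀ : OpenNormalSubgroup P := ⟨⊤, by change (⊤ : Subgroup P).Normal; infer_instance⟩
    let n : Multiplicative ℤ := (p V₀ : P × Multiplicative ℤ).2
    have hn : ∀ V, (p V : P × Multiplicative ℤ).2 = n := by
      intro V
      have hle : V ≤ V₀ := fun _ _ => trivial
      have hc := ((hN V₀ _).mp (hcompat V V₀ hle)).2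
      -- second component of `(p V₀)⁻¹ * p V` is `1`
      have : ((((p V₀)⁻¹ * p V : Γ) : P × Multiplicative ℤ)).2 =
          ((p V₀ : P × Multiplicative ℤ).2)⁻¹ * (p V : P × Multiplicative ℤ).2 := rfl
      rw [this] at hc
      exact (inv_mul_eq_one.mp hc).symm
    -- `(y₀, n) ∈ Γ`: `e y₀ = ι n`
    have hy₀V : ∀ V : OpenNormalSubgroup P, ((p V : P × Multiplicative ℤ).1)⁻¹ * y₀ ∈ V.toSubgroup :=
      fun V => QuotientGroup.eq.mp (hy₀ V)
    have hey : e y₀ = ι n := by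
      -- `(ι n)⁻¹ * e y₀` lies in every neighbourhood of `1`
      by_contra hne
      have hne' : (ι n)⁻¹ * e y₀ ≠ 1 := fun h => hne (inv_mul_eq_one.mp h).symm
      have hW : ({(ι n)⁻¹ * e y₀}ᶜ : Set Z) ∈ 𝓝 (1 : Z) :=
        (isOpen_compl_singleton).mem_nhds (by simpa using hne'.symm)
      -- continuity of `e` at `1` and the basis of open normal subgroups of `P`
      have hpre : e ⁻¹' ({(ι n)⁻¹ * e y₀}ᶜ) ∈ 𝓝 (1 : P) := by
        apply (map_continuous e).continuousAt.preimage_mem_nhds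
        simpa using hW
      obtain ⟨W, hWsub, hWopen, h1W⟩ := mem_nhds_iff.mp hpre
      obtain ⟨V, hV⟩ := ProfiniteGrp.exist_openNormalSubgroup_sub_open_nhds_of_one hWopen h1W
      have hv := hWsub (hV (hy₀V V))
      rw [Set.mem_preimage, Set.mem_compl_iff, Set.mem_singleton_iff, map_mul, map_inv] at hv
      apply hv
      have hpV : e (p V : P × Multiplicative ℤ).1 = ι n := by
        rw [← hn V]; exact (hΓ _).mp (p V).2
      rw [hpV]
    have hmem : ((y₀, n) : P × Multiplicative ℤ) ∈ Γ := (hΓ _).mpr hey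
    refine ⟨⟨(y₀, n), hmem⟩, fun M => ?_⟩
    -- for an arbitrary open normal `M`, pick `V` with `N V ≤ M`
    obtain ⟨V, N', -, hN', hN'M⟩ :=
      exists_openNormal_le_of_mem_nhds Γ (M.toOpenSubgroup.mem_nhds_one)
    have hNV_le : N V ≤ M := by
      intro q hq
      exact hN'M ((hN' q).mpr ((hN V q).mp hq))
    have h1 : x M = (p V : Γ ⧸ M.toSubgroup) := hx (N V) M hNV_le (p V) (hp V)
    rw [h1]
    apply QuotientGroup.eq.mpr
    apply hNV_le
    refine (hN V _).mpr ⟨?_, ?_⟩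
    · change ((p V : P × Multiplicative ℤ).1)⁻¹ * y₀ ∈ V
      exact hy₀V V
    · change ((p V : P × Multiplicative ℤ).2)⁻¹ * n = 1
      rw [hn V, inv_mul_cancel]

/-! ### Second countability, the discrete quotient, the first projection -/

omit [IsTopologicalGroup P] [CompactSpace P] [TotallyDisconnectedSpace P] in
/-- `Π` is second countable when `P` is (a subspace of `P × ℤ`; [IUTchI] Rmk. 2.5.3 (i) (T1)
"Galois-countable"). [cite: MochizukiSemiAnbd2006, Ex 3.10 p.43] -/
theorem secondCountableTopology [SecondCountableTopology P] : SecondCountableTopology Γ := by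
  haveI : Countable (Multiplicative ℤ) := Countable.of_equiv ℤ Multiplicative.ofAdd
  haveI : SecondCountableTopology (Multiplicative ℤ) :=
    DiscreteTopology.secondCountableTopology_of_countable
  haveI : SecondCountableTopology (P × Multiplicative ℤ) := inferInstance
  exact TopologicalSpace.Subtype.secondCountableTopology _

omit [IsTopologicalGroup P] [CompactSpace P] [TotallyDisconnectedSpace P] in
/-- The kernel of the discrete quotient `pr₂ : Π → ℤ` is OPEN ([EtTh] §1 p. 12: `Π^tp_Y := Ker(Π^tp_X ↠ Z)`
"determines an infinite étale covering"). [cite: MochizukiSemiAnbd2006, Ex 3.10 p.43] -/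
theorem isOpen_ker_snd :
    IsOpen (((MonoidHom.snd P (Multiplicative ℤ)).comp Γ.subtype).ker : Set Γ) := by
  have : (((MonoidHom.snd P (Multiplicative ℤ)).comp Γ.subtype).ker : Set Γ) =
      Subtype.val ⁻¹' ((Set.univ : Set P) ×ˢ ({1} : Set (Multiplicative ℤ))) := by
    ext q
    simp [MonoidHom.mem_ker]
  rw [this]
  exact (isOpen_univ.prod (isOpen_discrete _)).preimage continuous_subtype_val

omit [IsTopologicalGroup P] [CompactSpace P] [TotallyDisconnectedSpace P] [T2Space Z] in
include hΓ in
/-- The discrete quotient `pr₂ : Π → ℤ` is SURJECTIVE as soon as every `ι n` is a value of `e`.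
[cite: MochizukiSemiAnbd2006, Ex 3.10 p.43] -/
theorem snd_surjective_of (h : ∀ n : Multiplicative ℤ, ∃ x : P, e x = ι n) :
    Surjective ((MonoidHom.snd P (Multiplicative ℤ)).comp Γ.subtype) := by
  intro n
  obtain ⟨x, hx⟩ := h n
  exact ⟨⟨(x, n), (hΓ _).mpr hx⟩, rfl⟩

omit [IsTopologicalGroup P] [CompactSpace P] [TotallyDisconnectedSpace P] [T2Space Z] in
include hΓ in
/-- The first projection `pr₁ : Π → P` is INJECTIVE when `ι` is (the `ℤ`-component of `(x, n) ∈ Π` is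
determined by `e x = ι n`). [cite: MochizukiSemiAnbd2006, Prop 3.6(iii) p.38] -/
theorem fst_injective (hι : Injective ι) :
    Injective ((MonoidHom.fst P (Multiplicative ℤ)).comp Γ.subtype) := by
  rintro ⟨⟨x, n⟩, hq⟩ ⟨⟨x', n'⟩, hq'⟩ h
  change x = x' at h
  subst h
  have h1 := (hΓ _).mp hq
  have h2 := (hΓ _).mp hq'
  change e x = ι n at h1
  change e x = ι n' at h2
  have : n = n' := hι (h1.symm.trans h2)
  subst this
  rfl

omit [IsTopologicalGroup P] [CompactSpace P] [TotallyDisconnectedSpace P] in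
/-- The first projection `pr₁ : Π → P` as a continuous homomorphism has the slices in its fibres:
membership `q ∈ N_V ↔ pr₁ q ∈ V ∧ pr₂ q = 0` restated for the coercions used downstream.
[cite: MochizukiSemiAnbd2006, Def 3.1(i) p.33] -/
theorem continuous_fst_comp_subtype :
    Continuous ((MonoidHom.fst P (Multiplicative ℤ)).comp Γ.subtype) :=
  continuous_fst.comp continuous_subtype_val

end TemperedFibreProduct

end Literature.AnabelianGeometry.SemiGraphs

end
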